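import Summits.AtomisticToContinuum.HydrodynamicLimit.Theses.AntiMazurCoboundaries
import Summits.AtomisticToContinuum.HydrodynamicLimit.Theorems.KineticFluxLdDecay.Negative.WithoutOrthogonality
import Summits.AtomisticToContinuum.HydrodynamicLimit.Theorems.KineticFluxLdDecay.Negative.GibbsTilts
import Literature.Analysis.FluidPDE.HardSphereAlexander
import Literature.Analysis.FluidPDE.HardSphereFlowRegular
import Literature.MathematicalPhysics.KineticTheory.HardSphereEulerProofs

/-!
# Disproof work file — crux `KineticFluxLdDecay` (stmt-AtomisticToContinuum-10967)

Standing adversary record (cdisprove seat `refuter-cdisprove-stmt-AtomisticToContinuum-10967-0`).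
The crux (shared by routes `FluxGibbsianityLdDrude` r2 and `AntiMazurCoboundaries` r4):
for constant profiles `(a, θ, u₀)` and small reduced density `σ`, (A) the global Gibbs laws
`G_N = localGibbsLaw σ a u₀ θ N Φ` are probability measures and (B) there is an amplitude `κ > 0`
such that for every continuous `|φ| ≤ 1`, `|g| ≤ κ` with `g ⊥ span{1, v, |v|²}` in
`L²(stdGaussian ℝ³)` and every `δ > 0` there are a kinetic window `τ` and `N₀` with
`∫⁻ exp(h⁻¹ ∫₀ʰ ∑ᵢ φ(xᵢ(s)) g((vᵢ(s) − u₀)/√θ) ds) dG_N ≤ e^{δ(N+1)}`, `h = τ (N+1)^{-1/3}`,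
for all `N ≥ N₀` and EVERY hard-sphere flow `Φ`.

## Findings (cycle 1; v3 — all negative lemmas landed)

* READ-BACK / JUNK AUDIT: no formalisation-level kill. `G_N` has i.i.d. `N(u₀, θ)` velocities
  (`localGibbsProfile` = `a · M_{1,θ,u₀}`), so `w = (v − u₀)/√θ ∼ stdGaussian` and the
  orthogonality clause is consistent; every junk direction favours the statement
  (non-measurable integrand ⇒ smaller `∫⁻`; non-integrable time integral ⇒ Bochner `0` ⇒ `e⁰ = 1`).
  (A) holds for `σ ≤ 1/2` (`isProbabilityMeasure_localGibbsLaw`, PROVED in tree).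
* FLOWS ARE CONSTRUCTIBLE: Alexander's theorem on `T^d` is PROVED in the tree
  (`HardSphereFlow.nonempty_torus_holds`, and the jointly measurable `Alexander.regHardSphereFlow`),
  and the homogeneous Gibbs law is PROVED invariant under every flow
  (`Theorems.measurePreserving_flow_localGibbsLaw_const`). Hence every `¬`-lemma below is
  UNCONDITIONAL (no `modulo H`): a refutation of the crux itself, if it were false, would NOT be
  blocked by an unconstructible flow.
* § 2 LOAD-BEARING (proved): the orthogonality clause cannot be dropped —
  `kineticFluxLdDecay_false_without_orthogonality` (witness `φ ≡ 1`, `g ≡ κ`, `δ = κ/2`: the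
  window average is identically `(N+1)κ`).
* § 3 LOAD-BEARING (ALL PROVED AND LANDED — sorry-free, axioms standard — as the five-part series
  `Theorems/KineticFluxLdDecay/Negative/{TiltBasics, TiltLowerBound, TiltWitnessCalc, GibbsTilts,
  GibbsTiltsPhiBound}.lean` (p73676, p89719, p92109, p94854, p95189) plus `Negative/WithoutOrthogonality.lean`
  (p93997); § 3 below re-exports the landed theorems). Mechanism: Gibbs-tilt Donsker–Varadhan lower bound
  `KineticFluxLdDecayTilt.tilt_lower_bound`:
  `exp((N+1)·∫[g(u₁+√θ₁w) + llr1(u₁+√θ₁w)]dγ) ≤ ∫⁻ exp(h⁻¹∫₀ʰ Σᵢ g(vᵢ(s))ds) dG_N` for EVERY `h`, `N`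
  (reference law `a = θ = 1, u₀ = 0`, regular Alexander flow; `G_N = Q·e^{Σ llr1}` with equal partition
  functions, Jensen under the INVARIANT tilted Gibbs law `Q`, Fubini + `(Φ_s)_# Q = Q`), and exact
  Gaussian trigonometric moments `E cos(t + a wᵢ) = e^{-a²/2} cos t` (`charFun_stdGaussian`):
  - `⊥ v` cannot be dropped: `g = κ sin w₁`, drift tilt `t e₁`: gain `κ e^{-1/2} sin t` (first
    order) beats cost `t²/2`;
  - `⊥ |v|²` cannot be dropped: `g = κ (e^{-1/2} − cos w₁)` (mean zero, even, `E[w₁² cos w₁] = 0`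
    so `∫ g|w|² ≠ 0`), temperature tilt `θ(1+s)`: gain `κe^{-1/2}(1 − e^{-s/2})`
    beats cost `(3/2)(s − log(1+s))`;
  - the amplitude clause `∃ κ` cannot be replaced by "all bounded `g`":
    `g = 8 (cos w₁ − cos w₀)` is `⊥ span{1, v, |v|²}` (swap symmetry `w₀ ↔ w₁` + parity), and the
    drift tilt `e₀` gains `8 e^{-1/2} (1 − cos 1) ≥ 43/24` against cost `1/2`;
  - the normalisation `|φ| ≤ 1` cannot be dropped either (`φ ≡ 16/κ'` moves the amplitude into `φ⊗g`:
    `Theorems.kineticFluxLdDecay_false_without_phiBound`, LANDED in `Negative/GibbsTiltsPhiBound.lean`,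
    p95189; not re-exported here only to keep this file's imports one build behind the farm).
  These tilted laws are again homogeneous Gibbs laws, hence flow-invariant: the gain does not
  decay in `τ`, uniformly in `N` and in the flow — they are exact obstructions, not artefacts.
* § 4 TIGHTNESS FROM BELOW (LANDED, `KineticFluxLdDecayTilt.one_le_lintegral_exp_window` in
  `Negative/TiltLowerBound.lean`): for every
  CENTRED bounded continuous `g` the LD functional is `≥ 1` at every window and `N` (trivial tilt), so
  `δ < 0` is impossible — the crux asserts exactly `Λ_τ → 0⁺`.
* EXHAUSTION OF THE INVARIANT-TILT ATTACK (why the crux itself survives it): absolutely continuous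
  flow-invariant tilts of `G_N` have densities `f(E, P)` (Simányi ergodicity of the shells), i.e. are
  mixtures of homogeneous Gibbs laws; KL is convex and the gain linear, so pure Gibbs tilts `(u₁, θ₁)`
  are optimal, and for `g ⊥ span{1,v,|v|²}` their gain `E_{N(u₁,θ₁)} g` vanishes to FIRST order at
  `(0, 1)` with Hessian `≤ Cκ`, against the uniformly convex cost `‖u₁‖²/2 + (3/2)(s − log(1+s))`:
  unprofitable once `κ < κ*` (absolute). The DV duality with exactly invariant tilts therefore certifies
  the four clauses above as necessary AND cannot refute the crux; a refutation needs a NON-Gibbs,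
  kinetic-time-quasi-stationary structure (hidden charge) — none known for 3-d hard spheres.
* WHY THE CRUX RESISTS (for provers): with `g ⊥ span{1,v,|v|²}` and `|g| ≤ κ` small, every
  LOCAL-EQUILIBRIUM tilt (drift/temperature profiles, finite-`N` `(P,E)` shells) gains only at
  second order with coefficient `≤ Cκ` against a uniformly convex entropy cost — unprofitable for
  `κ < κ*` (absolute); hydrodynamic long-wavelength fluctuations surviving the window contribute
  `Λ_τ ≲ κ² k_c(τ)³ → 0` (`k_c ∼ (ντ)^{-1/2}`); cold comoving streams cost `3 log τ` per particle
  against gain `κ`; a collisionless fraction costs `∼ ντ` per particle. A counterexample needs a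
  finite-entropy-density, kinetic-time-stationary, NON-Maxwellian velocity structure of 3-d hard
  spheres at small density — a hidden extensive charge; none is known (d = 1 rods and the free gas
  `σ = 0` are the only exact witnesses, both excluded by the statement).
-/

noncomputable section

namespace Summit.AtomisticToContinuum.HydrodynamicLimit.Cruxes.KineticFluxLdDecay.Disproof

open MeasureTheory
open Literature.Analysis.FluidPDE Literature.MathematicalPhysics.KineticTheory
open Summit.AtomisticToContinuum.HydrodynamicLimit.Theses.AntiMazurCoboundaries (KineticFluxLdDecay)

/-! ## § 0 Frame -/

/-- The hard-sphere flows of the crux: `N + 1` spheres of diameter `σ (N+1)^{-1/3}` on `𝕋³`. -/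
abbrev Flow (σ : ℝ) (N : ℕ) : Type :=
  HardSphereFlow (Torus.geometry (Fin 3)) (hsDiameter σ N) (N + 1)

/-- The homogeneous (global) Gibbs law `G_N` of the crux. -/
abbrev gibbs (σ a θ : ℝ) (u₀ : V3) (N : ℕ) (Φ : Flow σ N) :
    Measure (Config (N + 1) (Fin 3) T3) :=
  localGibbsLaw σ (fun _ => a) (fun _ => u₀) (fun _ => θ) N Φ

/-- The kinetic window `h = τ (N+1)^{-1/3}`. -/
def window (τ : ℝ) (N : ℕ) : ℝ := τ * ((N + 1 : ℕ) : ℝ) ^ (-(1 / 3 : ℝ))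

theorem window_pos {τ : ℝ} (hτ : 0 < τ) (N : ℕ) : 0 < window τ N :=
  mul_pos hτ (Real.rpow_pos_of_pos (by positivity) _)

/-- The LD functional (left-hand side of the crux bound). -/
def ldLHS (σ a θ : ℝ) (u₀ : V3) (φ : T3 → ℝ) (g : V3 → ℝ) (τ : ℝ) (N : ℕ) (Φ : Flow σ N) :
    ENNReal :=
  ∫⁻ z, ENNReal.ofReal (Real.exp ((window τ N)⁻¹ * ∫ s in (0 : ℝ)..window τ N,
    ∑ i, φ (Φ.flow s z i).1 * g ((Real.sqrt θ)⁻¹ • ((Φ.flow s z i).2 - u₀)))) ∂(gibbs σ a θ u₀ N Φ)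

/-- The orthogonality clause of the crux: `g ⊥ span{1, v, |v|²}` in `L²(stdGaussian ℝ³)`. -/
def Orthogonal (g : V3 → ℝ) : Prop :=
  ∀ (c₀ c₂ : ℝ) (b : V3),
    ∫ v, g v * (c₀ + inner ℝ b v + c₂ * ‖v‖ ^ 2) ∂(ProbabilityTheory.stdGaussian V3) = 0

/-- The crux with the hypothesis on `g` abstracted to a predicate `P` (orthogonality / amplitude
variants below are instances). `P κ g` is the admissibility of `g` at amplitude `κ`. -/
def CruxWith (P : ℝ → (V3 → ℝ) → Prop) : Prop :=
  ∀ (a θ : ℝ) (u₀ : V3), 0 < a → 0 < θ → ∃ σ₀ : ℝ, 0 < σ₀ ∧ ∀ σ : ℝ, 0 < σ → σ < σ₀ →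
    (∀ (N : ℕ) (Φ : Flow σ N), IsProbabilityMeasure (gibbs σ a θ u₀ N Φ)) ∧
    ∃ κ : ℝ, 0 < κ ∧ ∀ (φ : T3 → ℝ) (g : V3 → ℝ), Continuous φ → Continuous g →
      (∀ x, |φ x| ≤ 1) → P κ g → ∀ δ : ℝ, 0 < δ → ∃ τ : ℝ, 0 < τ ∧ ∃ N₀ : ℕ, ∀ N : ℕ, N₀ ≤ N →
        ∀ Φ : Flow σ N, ldLHS σ a θ u₀ φ g τ N Φ ≤ ENNReal.ofReal (Real.exp (δ * (N + 1)))

/-- The crux is `CruxWith` the conjunction "amplitude `|g| ≤ κ` and orthogonality". -/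
theorem kineticFluxLdDecay_iff :
    KineticFluxLdDecay ↔ CruxWith fun κ g => (∀ v, |g v| ≤ κ) ∧ Orthogonal g := by
  unfold KineticFluxLdDecay CruxWith ldLHS window gibbs Orthogonal
  constructor
  · intro h a θ u₀ ha hθ
    obtain ⟨σ₀, hσ₀, H⟩ := h a θ u₀ ha hθ
    refine ⟨σ₀, hσ₀, fun σ hσ hσ' => ?_⟩
    obtain ⟨hA, κ, hκ, hB⟩ := H σ hσ hσ'
    exact ⟨hA, κ, hκ, fun φ g hφ hg hφ1 hP => hB φ g hφ hg hφ1 hP.1 hP.2⟩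
  · intro h a θ u₀ ha hθ
    obtain ⟨σ₀, hσ₀, H⟩ := h a θ u₀ ha hθ
    refine ⟨σ₀, hσ₀, fun σ hσ hσ' => ?_⟩
    obtain ⟨hA, κ, hκ, hB⟩ := H σ hσ hσ'
    exact ⟨hA, κ, hκ, fun φ g hφ hg hφ1 hgκ horth => hB φ g hφ hg hφ1 ⟨hgκ, horth⟩⟩

/-- Monotonicity of `CruxWith` in the admissibility predicate: admitting MORE observables gives a
STRONGER statement. -/
theorem cruxWith_mono {P Q : ℝ → (V3 → ℝ) → Prop} (hPQ : ∀ κ g, P κ g → Q κ g) :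
    CruxWith Q → CruxWith P := by
  intro h a θ u₀ ha hθ
  obtain ⟨σ₀, hσ₀, H⟩ := h a θ u₀ ha hθ
  refine ⟨σ₀, hσ₀, fun σ hσ hσ' => ?_⟩
  obtain ⟨hA, κ, hκ, hB⟩ := H σ hσ hσ'
  exact ⟨hA, κ, hκ, fun φ g hφ hg hφ1 hP => hB φ g hφ hg hφ1 (hPQ κ g hP)⟩

/-! ## § 1 Flows exist (Alexander's theorem, PROVED in the tree) -/

/-- For `0 < σ < 1/2` the hard-sphere flows of the crux exist at every `N`
(`HardSphereFlow.nonempty_torus_holds`, diameter `σ(N+1)^{-1/3} ≤ σ < 1/2`). -/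
theorem flow_nonempty {σ : ℝ} (hσ : 0 < σ) (hσ' : σ < 2⁻¹) (N : ℕ) : Nonempty (Flow σ N) :=
  HardSphereFlow.nonempty_torus_holds (d := Fin 3) (hsDiameter_pos hσ N)
    ((hsDiameter_le hσ.le N).trans_lt hσ') (N + 1)

/-! ## § 2 The orthogonality clause is load-bearing (proved) -/

/-- The crux with the orthogonality clause DROPPED (only `|g| ≤ κ` kept). -/
def KineticFluxLdDecayWithoutOrthogonality : Prop :=
  CruxWith fun κ g => ∀ v, |g v| ≤ κ

/-- Sanity: the variant is the crux minus exactly the orthogonality clause (it implies the crux). -/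
theorem kineticFluxLdDecay_of_withoutOrthogonality :
    KineticFluxLdDecayWithoutOrthogonality → KineticFluxLdDecay := by
  rw [kineticFluxLdDecay_iff]
  exact cruxWith_mono fun κ g h => h.1

/-- The LD functional of a CONSTANT observable `φ ≡ 1`, `g ≡ c`: the window average is
identically `(N+1) c`, whatever the flow. -/
theorem ldLHS_const (σ a θ : ℝ) (u₀ : V3) (c τ : ℝ) (hτ : 0 < τ) (N : ℕ) (Φ : Flow σ N)
    [IsProbabilityMeasure (gibbs σ a θ u₀ N Φ)] :
    ldLHS σ a θ u₀ (fun _ => 1) (fun _ => c) τ N Φ =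
      ENNReal.ofReal (Real.exp (((N + 1 : ℕ) : ℝ) * c)) := by
  have hh : window τ N ≠ 0 := (window_pos hτ N).ne'
  simp only [ldLHS, one_mul, Finset.sum_const, Finset.card_univ, Fintype.card_fin, nsmul_eq_mul,
    intervalIntegral.integral_const, sub_zero, smul_eq_mul, ← mul_assoc, inv_mul_cancel₀ hh,
    lintegral_const, measure_univ, mul_one]

/-- **Any proof must use the orthogonality clause**: without it the statement is false
(witness `a = θ = 1`, `u₀ = 0`, `φ ≡ 1`, `g ≡ κ`, `δ = κ/2`; the flow is Alexander's). -/
theorem kineticFluxLdDecay_false_without_orthogonality :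
    ¬ KineticFluxLdDecayWithoutOrthogonality := by
  intro h
  obtain ⟨σ₀, hσ₀, H⟩ := h 1 1 0 one_pos one_pos
  set σ : ℝ := min (σ₀ / 2) 4⁻¹ with hσdef
  have hσpos : 0 < σ := lt_min (by positivity) (by norm_num)
  have hσlt : σ < σ₀ := (min_le_left _ _).trans_lt (by linarith)
  have hσhalf : σ < 2⁻¹ := (min_le_right _ _).trans_lt (by norm_num)
  obtain ⟨hA, κ, hκ, hB⟩ := H σ hσpos hσlt
  obtain ⟨τ, hτ, N₀, hN⟩ := hB (fun _ => 1) (fun _ => κ) continuous_const continuous_const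
    (fun _ => by simp) (fun _ => by simp [abs_of_pos hκ]) (κ / 2) (by positivity)
  obtain ⟨Φ⟩ := flow_nonempty hσpos hσhalf N₀
  haveI := hA N₀ Φ
  have key := hN N₀ le_rfl Φ
  rw [ldLHS_const σ 1 1 0 κ τ hτ N₀ Φ, ENNReal.ofReal_le_ofReal_iff (Real.exp_pos _).le,
    Real.exp_le_exp] at key
  have hpos : (0 : ℝ) < ((N₀ + 1 : ℕ) : ℝ) := by positivity
  push_cast at key hpos
  nlinarith

/-! ## § 3 Finer load-bearing analysis: `⊥ v`, `⊥ |v|²` and the amplitude clause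
(PROVED and LANDED in `Theorems/KineticFluxLdDecay/Negative/GibbsTilts.lean` — Gibbs-tilt Donsker–Varadhan
lower bound; the Disproof variants `CruxWith …` are definitionally the landed `KineticFluxLdDecayWith …`) -/

/-- Orthogonality to the EVEN collision invariants `1, |v|²` only (`⊥ v` dropped). -/
def OrthogonalEven (g : V3 → ℝ) : Prop :=
  ∀ (c₀ c₂ : ℝ), ∫ v, g v * (c₀ + c₂ * ‖v‖ ^ 2) ∂(ProbabilityTheory.stdGaussian V3) = 0

/-- Orthogonality to `1, v` only (`⊥ |v|²` dropped). -/
def OrthogonalOneVel (g : V3 → ℝ) : Prop :=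
  ∀ (c₀ : ℝ) (b : V3), ∫ v, g v * (c₀ + inner ℝ b v) ∂(ProbabilityTheory.stdGaussian V3) = 0

/-- The crux with `⊥ v` dropped from the orthogonality clause. -/
def KineticFluxLdDecayWithoutOrthVel : Prop :=
  CruxWith fun κ g => (∀ v, |g v| ≤ κ) ∧ OrthogonalEven g

/-- The crux with `⊥ |v|²` dropped from the orthogonality clause. -/
def KineticFluxLdDecayWithoutOrthEnergy : Prop :=
  CruxWith fun κ g => (∀ v, |g v| ≤ κ) ∧ OrthogonalOneVel g

/-- The crux with the amplitude clause dropped: ALL bounded continuous orthogonal `g`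
(the `κ` of `CruxWith` is then unused). -/
def KineticFluxLdDecayAllAmplitudes : Prop :=
  CruxWith fun _ g => (∃ K : ℝ, ∀ v, |g v| ≤ K) ∧ Orthogonal g

theorem kineticFluxLdDecay_of_withoutOrthVel :
    KineticFluxLdDecayWithoutOrthVel → KineticFluxLdDecay := by
  rw [kineticFluxLdDecay_iff]
  exact cruxWith_mono fun κ g h => ⟨h.1, fun c₀ c₂ => by simpa using h.2 c₀ c₂ 0⟩

theorem kineticFluxLdDecay_of_withoutOrthEnergy :
    KineticFluxLdDecayWithoutOrthEnergy → KineticFluxLdDecay := by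
  rw [kineticFluxLdDecay_iff]
  exact cruxWith_mono fun κ g h => ⟨h.1, fun c₀ b => by simpa using h.2 c₀ 0 b⟩

theorem kineticFluxLdDecay_of_allAmplitudes :
    KineticFluxLdDecayAllAmplitudes → KineticFluxLdDecay := by
  rw [kineticFluxLdDecay_iff]
  exact cruxWith_mono fun κ g h => ⟨⟨κ, h.1⟩, h.2⟩

/-- LANDED (`Theorems.kineticFluxLdDecay_false_without_orthVel`, `Negative/GibbsTilts.lean`): `⊥ v` is load-bearing.
Witness `g = κ' sin w₀` (`κ' = min κ 1`), `φ ≡ 1`, drift tilt `t e₀`, `t = κ' e^{-1/2}`: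
per-particle pressure `≥ t sin t − t²/2 ≥ t²/4` at every window, against `δ = t²/8`. -/
theorem kineticFluxLdDecay_false_without_orthVel : ¬ KineticFluxLdDecayWithoutOrthVel :=
  Summit.AtomisticToContinuum.HydrodynamicLimit.Theorems.kineticFluxLdDecay_false_without_orthVel

/-- LANDED (`Theorems.kineticFluxLdDecay_false_without_orthEnergy`, `Negative/GibbsTilts.lean`): `⊥ |v|²` is
load-bearing. Witness `g = (κ'/2)(e^{-1/2} − cos w₀)` (centred, even, `⊥ v`), temperature tilt `1 + s`,
`s = κ' e^{-1/2}/24`: gain `≥ κ' e^{-1/2} s/8 = 3s²`, cost `≤ (3/2)s²`, against `δ = s²`. -/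
theorem kineticFluxLdDecay_false_without_orthEnergy : ¬ KineticFluxLdDecayWithoutOrthEnergy :=
  Summit.AtomisticToContinuum.HydrodynamicLimit.Theorems.kineticFluxLdDecay_false_without_orthEnergy

/-- LANDED (`Theorems.kineticFluxLdDecay_false_allAmplitudes`, `Negative/GibbsTilts.lean`): the amplitude clause is
load-bearing. Witness `g = 8 (cos w₁ − cos w₀)` (`⊥ span{1, v, |v|²}` by the swap `w₀ ↔ w₁` and parity),
drift tilt `e₀`: gain `8 e^{-1/2}(1 − cos 1) ≥ 43/24` vs cost `1/2`, against `δ = 1/2`. -/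
theorem kineticFluxLdDecay_false_allAmplitudes : ¬ KineticFluxLdDecayAllAmplitudes :=
  Summit.AtomisticToContinuum.HydrodynamicLimit.Theorems.kineticFluxLdDecay_false_allAmplitudes

/-! ## § 4 Tightness from below and the Gibbs-tilt functional -/

/-- The per-particle log-likelihood ratio between the reference Maxwellian (`θ = 1`, `u = 0`) and the
tilted one (drift `u₁`, temperature `θ₁`); closed form `(3/2) log θ₁ − ‖v‖²/2 + ‖v − u₁‖²/(2θ₁)`
(evidence file: `KineticFluxLdDecayTilt.llr1`, `llr1_eq`). -/
def llr1 (θ₁ : ℝ) (u₁ : V3) (v : V3) : ℝ :=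
  Real.log (localMaxwellian 1 1 (0 : V3) v) - Real.log (localMaxwellian 1 θ₁ u₁ v)

/-- The GIBBS-TILT FUNCTIONAL `Γ(g; u₁, θ₁) = E_{N(u₁,θ₁)} g − KL(N(u₁,θ₁) ‖ N(0,1))`, written as one
Gaussian integral. The evidence file proves (`tilt_lower_bound`)
`exp((N+1) Γ) ≤ ∫⁻ exp(window average of ∑ᵢ g(vᵢ)) dG_N` for every window and every `N`. -/
def tiltFunctional (g : V3 → ℝ) (u₁ : V3) (θ₁ : ℝ) : ℝ :=
  ∫ w, (g (u₁ + Real.sqrt θ₁ • w) + llr1 θ₁ u₁ (u₁ + Real.sqrt θ₁ • w))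
    ∂(ProbabilityTheory.stdGaussian V3)

/-- NEAR-MISS / POSITIVE META-STATEMENT (paper proof only; NOT a consequence of the crux, but the reason
the invariant-tilt attack of § 3 cannot refute it): there is an ABSOLUTE amplitude `κ₀ > 0` such that for
every admissible observable of the crux (`|g| ≤ κ ≤ κ₀`, `g ⊥ span{1, v, |v|²}`) the Gibbs-tilt functional
is `≤ 0` for ALL drifts and temperatures — so `tilt_lower_bound` only ever certifies `Λ ≥ 0`.
Paper proof: `G(u₁,θ₁) := E_{N(u₁,θ₁)} g` is smooth, `G(0,1) = 0` and `∇G(0,1) = 0` BY THE THREE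
ORTHOGONALITY CONDITIONS, `‖∇²G‖ ≤ Cκ` on `{‖u₁‖ ≤ 1, θ₁ ∈ [1/2, 2]}` and `|G| ≤ 2κ` everywhere (total
variation), while `KL = ‖u₁‖²/2 + (3/2)(θ₁ − 1 − log θ₁)` is `≥ c(‖u₁‖² + (θ₁−1)²)` near `(0,1)` and `≥ c₁`
outside. Obstruction to formalising: second-order Taylor expansion of Gaussian shifts/dilations against a
merely bounded `g` (differentiation under the integral sign) — routine but long; not needed for any
verdict. -/
theorem tiltFunctional_nonpos_of_admissible :
    ∃ κ₀ : ℝ, 0 < κ₀ ∧ ∀ (g : V3 → ℝ), Continuous g → (∀ v, |g v| ≤ κ₀) → Orthogonal g →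
      ∀ (u₁ : V3) (θ₁ : ℝ), 0 < θ₁ → tiltFunctional g u₁ θ₁ ≤ 0 := by
  sorry

end Summit.AtomisticToContinuum.HydrodynamicLimit.Cruxes.KineticFluxLdDecay.Disproof
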